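import Summits.PneNP.PneNP.Theorems.LtfLocalAvoidFP
import Summits.PneNP.PneNP.Theorems.SignDegCertBridge

/-!
# F-N2a leaf: range avoidance for `LTF`-local maps (all tables of sign-degree ≤ 1) at linear stretch is in FP

Cell pnp-ideate, ROUND-17 rung F-N2a (`--supports stmt-PneNP-19007`).  The statement
`LocalAvoidLinearFP k (fun _ _ I => ∀ j, SignDegLE 1 (I.table j))` (literally; it is the body of
pnp-ideate-p3's rung statement `SignDeg2Signing.SignDeg1AvoidLinearFP k`, which unfolds to it) is proved for
EVERY locality `k`, by composing

* the mathematics `SignDegCertBridge.greedyAvoid_not_mem_range` (p3: uniform integer margin certificates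
  `certOf k 1` of weight `uniformW k 1` for all `k`-bit tables of sign-degree ≤ 1, fed to the weighted
  one-pass greedy signing `LtfGreedySigning.greedyBitsW`; outside the range once `m > (n+1)·W²`), with
* the machine `LtfLocalAvoidFP.ltfStr k F0 F1` (this seat: decode the instance code, look the certificate
  rows up in the FINITE table `SignDegCertBridge.rowTable k` — `2^(2ᵏ)` entries, a machine constant —,
  run the pass; `readOut_ltfStr` + `isPolyTime_ltfStr`), the rows being table-determined by
  `SignDegCertBridge.greedyAvoid_c0/_c1`.

Constant: `C = 2·(uniformW k 1)² + 1`.  Placement (honest): restricted-model algorithmic rung of the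
range-avoidance ladder — per-`k` linear stretch for the sign-degree-1 (linear threshold) tables, where
print has `m > n²` for one-intersecting `MAJ_k` [KuntewarSarma2025, Thm. 6] and the oblivious
`FP^NP` hitting sets of [GuruswamiLyuWang2025, Thm. 33]; it does not touch `Nc03AvoidLinearFP`
(sign-degree 2 tables such as `CAND` are outside the class) and has no bearing on `P` versus `NP`.
-/

set_option linter.dupNamespace false -- `Summit.PneNP.PneNP.…`: summit = sub-problem name (D-0017 single-conjunct layout)

namespace Summit.PneNP.PneNP.Theorems.SignDeg1AvoidFP

open Literature.Computability.Complexity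
open Summit.PneNP.PneNP.Theorems.SignDegCertBridge
open Summit.PneNP.PneNP.Theorems.LtfLocalAvoidFP

variable {k n m : ℕ}

/-- The machine's bias table: `P ↦ (rowTable k P).1`. -/
noncomputable def biasTab (k : ℕ) (P : (Fin k → Bool) → Bool) : ℤ := (rowTable k P).1

/-- The machine's linear-coefficient table: `P ↦ (rowTable k P).2`. -/
noncomputable def linTab (k : ℕ) (P : (Fin k → Bool) → Bool) (i : Fin k) : ℤ := (rowTable k P).2 i

/-- **THE AVOIDER** for `LTF`-local maps: the weighted greedy pass driven by the finite row table. -/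
noncomputable def sd1Str (k : ℕ) : List Bool → List Bool := ltfStr k (biasTab k) (linTab k)

/-- On the code of an `LTF`-local instance the avoider prints p3's greedy point `greedyAvoid I h`. -/
theorem readOut_sd1Str (I : LocalMap k n m) (h : ∀ j, SignDegLE 1 (I.table j)) :
    readOut m (sd1Str k I.encode) = greedyAvoid I h :=
  readOut_ltfStr I _ (fun j => greedyAvoid_c0 I h j) (fun j i => greedyAvoid_c1 I h j i)

/-- The avoider is polynomial time. -/
theorem isPolyTime_sd1Str (k : ℕ) : IsPolyTime (sd1Str k) := isPolyTime_ltfStr k _ _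

/-- The stretch arithmetic: `m ≥ (2W² + 1)·n`, `n ≥ 1` ⇒ `(n+1)·W² < m`. -/
theorem stretch_lt {W : ℤ} {n m : ℕ} (hn : 0 < n) (hm : (2 * W.toNat ^ 2 + 1) * n ≤ m) (hW : 0 ≤ W) :
    ((n : ℤ) + 1) * W ^ 2 < m := by
  have hWn : ((W.toNat : ℕ) : ℤ) = W := Int.toNat_of_nonneg hW
  have hn' : (1 : ℤ) ≤ n := by exact_mod_cast hn
  have hm' : ((2 * ((W.toNat : ℕ) : ℤ) ^ 2 + 1) * n) ≤ (m : ℤ) := by exact_mod_cast hm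
  rw [hWn] at hm'
  calc ((n : ℤ) + 1) * W ^ 2 ≤ 2 * n * W ^ 2 := mul_le_mul_of_nonneg_right (by linarith) (sq_nonneg _)
    _ < (2 * W ^ 2 + 1) * n := by nlinarith
    _ ≤ m := hm'

/-- **F-N2a leaf for every `k`** (`= SignDeg2Signing.SignDeg1AvoidLinearFP k`, stated literally): `NC⁰ₖ` range
avoidance restricted to maps all of whose output tables have sign-degree ≤ 1 (linear threshold tables,
repeated reads allowed) is solved at linear stretch `m ≥ (2·(uniformW k 1)² + 1)·n` by ONE polynomial-time
string function.  (Restricted-model algorithmic rung; no bearing on `P ≠ NP`.) -/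
theorem signDeg1_localAvoidLinearFP (k : ℕ) :
    LocalAvoidLinearFP k (fun _ _ I => ∀ j, SignDegLE 1 (I.table j)) := by
  refine ⟨2 * (uniformW k 1).toNat ^ 2 + 1, sd1Str k, isPolyTime_sd1Str k, fun n m I hI hn hm => ?_⟩
  rw [readOut_sd1Str I hI]
  exact greedyAvoid_not_mem_range I hI (stretch_lt hn hm (uniformW_nonneg k 1))

end Summit.PneNP.PneNP.Theorems.SignDeg1AvoidFP
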